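import Summits.CriticalPhenomena.PercolationContinuityZ3.Theorems.Transplant.SkelNegBParamsLO
import Summits.CriticalPhenomena.PercolationContinuityZ3.Theorems.Transplant.SkelNegBParamsLFA
import HarnessLib

/-!
# N1 params, chain of record `NegB`, part LO-A — the (ζ′) twin of part LO (p28xxxx) at the coarse-lattice constant `A := Aof κ = 20·K`: THE FINE WINDOW MAP OF
# RECORD, ORIENTED, **`NegB.fineOA := fineA κ Φ t p (D.orient DT ori) g f φL`**, and THE SCHEME-GEOMETRY PACKAGE of the (ζ′) cells `fcellsA`
# (`geom_fineA_at` / `geom_fineOA_of_factsO`: the nine conjuncts of `GeomHoldsN(O)` for `Γ := cellGeomSG₂ G fineOA fcellsA t Λ`, `FD := faceDataSG …`,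
# `LD := levelDataS …`, modulo the schedule's `WFS2 fcellsA Λ` and the column floor `NrepA (cen x) + 1 ≤ rQ a x`) (stmt-g16 2026-08-22; NEG-SCOPE §B.19 (ζ′))
The orientation bits and maps `oL/φL` (`lip_φL`, `steps_φL`), `pairs_adm`, and the clauses from `FactsO` (`clauseL_of_factsO`, `eqNumL_of_factsO`) are part LO's,
REUSED unchanged (they do not read the cells).
builds on p205010 (kernel theorem, internal audit signed; external expert review pending) — nothing in this file uses p205010; NOTHING is claimed about the node
`SamePDropOfSkeletonNeg₁` (OPEN; additive closure adopted on accept).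
Lane `prim-bschramm-*`, seat `prim-bschramm-stmt` (gen 16); helper file (`--supports stmt-CriticalPhenomena-4575 --as helper`); ledger HOME/prim-bschramm-stmt/NEG-PARAMS.md.
* §1 **`fineOA`**, `fineOA_eq`; §2 **`geom_fineA_at`** (map slot `φ′`), **`geom_fineOA_of_factsO`**.
[cite: KozmaNitzan2024, §4 Theorem 6 (pp. 25–31), pp. 25–27 (Q_v, M_v, E_{v,x}, H^j_{v,x})] [cite: MartineauTassion2017, §3.2 Lemma 3.5, §4.3]
-/

noncomputable section

open scoped Classical

namespace Summit.CriticalPhenomena.PercolationContinuityZ3.Theorems.Transplant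

namespace PlanarSkeletonNeg

namespace NegB

open Literature.Probability.Percolation Literature.Probability.LatticeModels SimpleGraph KNCells
open SkelConc (Consts)
open BoxProdZ2 (ConcRadiiG)
open Skelφ (oriφ trφ)
open Skelφ.StepI (DataN)
open Neg

section LOLevel

variable (κ : Consts) {V : Type} [DecidableEq V] [Countable V] {G : SimpleGraph V} [G.LocallyFinite] (Φ : PlanarSkeletonNeg G) (t : V)
  (p : unitInterval) (D DT : DataN V) (ori : V → ℕ → ℕ → Bool) (g f : ℕ)

/-! ## §1 The oriented fine window map of the (ζ′) chain -/

/-- **THE FINE WINDOW MAP OF RECORD OF THE (ζ′) CHAIN, ORIENTED**: `fineOA := fineA κ Φ t p (orient D DT ori) g f φL`. [this work] -/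
def fineOA : V → Site 2 := fineA κ Φ t p (D.orient DT ori) g f (φL κ Φ t p D DT ori g f)

/-- `fineOA` unfolded. [folklore] -/
theorem fineOA_eq : fineOA κ Φ t p D DT ori g f = fineA κ Φ t p (D.orient DT ori) g f (φL κ Φ t p D DT ori g f) := rfl

/-! ## §2 The scheme-geometry package of the (ζ′) cells -/

/-- **THE NINE `GeomHoldsN` CONJUNCTS FOR THE (ζ′) CELLS, map slot `φ′`**: with `Γ := cellGeomSG₂ G (fineA … φ′) fcellsA t Λ`, `FD := faceDataSG …`, `LD := levelDataS …`:
`Γ.root = t`, `κ.K₀ ≤ Γ.K`, `Lip`, `RunGeom`, `AnchGeom`, `SepGeom₂`, `ExitGeom`, `StepsGeom`, `LevelGeom` — from `Lip G φ′`, `Steps G φ′`, the numeric long clause,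
`WFS2 fcellsA Λ` and the column floor `NrepA (cen x) + 1 ≤ Λ.rQ a x`. [cite: KozmaNitzan2024, §4 pp. 25–29] -/
theorem geom_fineA_at {φ' : V → Site 2} (hlip : Skelφ.Lip G φ') (hstep : Skelφ.Steps G φ') (hN : EqNumL κ Φ t p D g f) {Λ : ConcRadiiG}
    (hΛ : Skelφ.WFS2 (fcellsA κ Φ t p D g f) Λ) (hcolQ : ∀ a x, NrepA κ Φ t p D g f ((fcellsA κ Φ t p D g f).cen x) + 1 ≤ Λ.rQ a x) :
    (Skelφ.cellGeomSG₂ G (fineA κ Φ t p D g f φ') (fcellsA κ Φ t p D g f) t Λ).root = t ∧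
      κ.K₀ ≤ (Skelφ.cellGeomSG₂ G (fineA κ Φ t p D g f φ') (fcellsA κ Φ t p D g f) t Λ).K ∧
      Skelφ.Lip G (fineA κ Φ t p D g f φ') ∧
      RunGeom G (Skelφ.cellGeomSG₂ G (fineA κ Φ t p D g f φ') (fcellsA κ Φ t p D g f) t Λ) ∧
      AnchGeom (Skelφ.cellGeomSG₂ G (fineA κ Φ t p D g f φ') (fcellsA κ Φ t p D g f) t Λ) ∧
      SepGeom₂ G (Skelφ.cellGeomSG₂ G (fineA κ Φ t p D g f φ') (fcellsA κ Φ t p D g f) t Λ) ∧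
      ExitGeom G (Skelφ.cellGeomSG₂ G (fineA κ Φ t p D g f φ') (fcellsA κ Φ t p D g f) t Λ) ∧
      StepsGeom (Skelφ.cellGeomSG₂ G (fineA κ Φ t p D g f φ') (fcellsA κ Φ t p D g f) t Λ)
        (Skelφ.faceDataSG G (fineA κ Φ t p D g f φ') (fcellsA κ Φ t p D g f) t Λ) ∧
      LevelGeom G (Skelφ.cellGeomSG₂ G (fineA κ Φ t p D g f φ') (fcellsA κ Φ t p D g f) t Λ)
        (Skelφ.faceDataSG G (fineA κ Φ t p D g f φ') (fcellsA κ Φ t p D g f) t Λ) (Skelφ.levelDataS (fineA κ Φ t p D g f φ') (fcellsA κ Φ t p D g f)) := by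
  have hψ0 := fineA_base_at κ Φ t p D g f φ' hN
  have hlipψ := lip_fineA_at κ Φ t p D g f hlip hN
  have hws := weakSteps_fineA_at κ Φ t p D g f hstep hN
  have hcol := hcol_fineA_of_sched κ Φ t p D g f hlip hstep hN hcolQ
  refine ⟨rfl, (fcellsA_K κ Φ t p D g f).2.1, hlipψ, Skelφ.runGeomSG₂ _ _, Skelφ.anchGeomSG₂ _ _, Skelφ.sepGeom₂SG₂ _ _ hΛ hψ0 hlipψ hws hcol,
    Skelφ.exitGeomSG₂ _ _ hΛ hlipψ, Skelφ.stepsGeomSG₂ _ _ hΛ hlipψ hws, Skelφ.levelGeomSG₂ _ _ hΛ hlipψ⟩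

/-- **THE NINE `GeomHoldsNO` CONJUNCTS FOR THE (ζ′) CELLS OF RECORD, ORIENTED** — from `FactsO`'s shared radius and clauses, for every schedule with `WFS2` and the column
floor. [cite: KozmaNitzan2024, §4 pp. 25–29] -/
theorem geom_fineOA_of_factsO (hR : DT.R = D.R)
    (hfacts : ∀ M, D.M₀ ≤ M → ∀ n, D.n₁ M ≤ n →
      (ori t M n = true → D.EqGeom G Φ.φ t M n ∧ (D.hgt t M n).natAbs ≤ 10 * n) ∧
      (ori t M n = false → DT.EqGeom G (trφ Φ.φ) t M n ∧ (DT.hgt t M n).natAbs ≤ 10 * n))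
    {Λ : ConcRadiiG} (hΛ : Skelφ.WFS2 (fcellsA κ Φ t p (D.orient DT ori) g f) Λ)
    (hcolQ : ∀ a x, NrepA κ Φ t p (D.orient DT ori) g f ((fcellsA κ Φ t p (D.orient DT ori) g f).cen x) + 1 ≤ Λ.rQ a x) :
    (Skelφ.cellGeomSG₂ G (fineOA κ Φ t p D DT ori g f) (fcellsA κ Φ t p (D.orient DT ori) g f) t Λ).root = t ∧
      κ.K₀ ≤ (Skelφ.cellGeomSG₂ G (fineOA κ Φ t p D DT ori g f) (fcellsA κ Φ t p (D.orient DT ori) g f) t Λ).K ∧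
      Skelφ.Lip G (fineOA κ Φ t p D DT ori g f) ∧
      RunGeom G (Skelφ.cellGeomSG₂ G (fineOA κ Φ t p D DT ori g f) (fcellsA κ Φ t p (D.orient DT ori) g f) t Λ) ∧
      AnchGeom (Skelφ.cellGeomSG₂ G (fineOA κ Φ t p D DT ori g f) (fcellsA κ Φ t p (D.orient DT ori) g f) t Λ) ∧
      SepGeom₂ G (Skelφ.cellGeomSG₂ G (fineOA κ Φ t p D DT ori g f) (fcellsA κ Φ t p (D.orient DT ori) g f) t Λ) ∧
      ExitGeom G (Skelφ.cellGeomSG₂ G (fineOA κ Φ t p D DT ori g f) (fcellsA κ Φ t p (D.orient DT ori) g f) t Λ) ∧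
      StepsGeom (Skelφ.cellGeomSG₂ G (fineOA κ Φ t p D DT ori g f) (fcellsA κ Φ t p (D.orient DT ori) g f) t Λ)
        (Skelφ.faceDataSG G (fineOA κ Φ t p D DT ori g f) (fcellsA κ Φ t p (D.orient DT ori) g f) t Λ) ∧
      LevelGeom G (Skelφ.cellGeomSG₂ G (fineOA κ Φ t p D DT ori g f) (fcellsA κ Φ t p (D.orient DT ori) g f) t Λ)
        (Skelφ.faceDataSG G (fineOA κ Φ t p D DT ori g f) (fcellsA κ Φ t p (D.orient DT ori) g f) t Λ)
        (Skelφ.levelDataS (fineOA κ Φ t p D DT ori g f) (fcellsA κ Φ t p (D.orient DT ori) g f)) :=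
  geom_fineA_at κ Φ t p (D.orient DT ori) g f (lip_φL κ Φ t p D DT ori g f) (steps_φL κ Φ t p D DT ori g f) (eqNumL_of_factsO κ Φ t p D DT ori g f hR hfacts)
    hΛ hcolQ

end LOLevel

end NegB

end PlanarSkeletonNeg

end Summit.CriticalPhenomena.PercolationContinuityZ3.Theorems.Transplant

end
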